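import Summits.Langlands.Langlands.Theorems.PhantomRMYoshidaResiduallyYoshidaLiftingRibetClassUniqueResidual
import HarnessLib

/-!
# Invariant subspaces of a non-split `(σ, B; 0, σ')` (stub `stub_nonsplitInvariantSubspaces`) — line `sector-klingen-split`

Stub-worker of lead prover-line-stmt-Langlands-13639-c3-0 (cycle 3, 2026-08-17).  For `σ, σ' : Γ → GL₂(k)` irreducible and `B` not a
coboundary, the subspaces of `k² ⊕ k²` stable under every `(σ g, B g; 0, σ' g)` are exactly `0`, the `σ`-plane `k² ⊕ 0`, and everything:
the image of a stable `W` in the quotient `σ'` is `0` or all (irreducibility of `σ'`); in the first case `W ⊆ σ`-plane is `0` or the plane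
(irreducibility of `σ`); in the second, `W ∩ (σ`-plane`)` is `0` or the plane — the plane gives `W = ⊤`, and `0` makes `W` the graph of some
`X : k² → k²`, whose stability says `B = σ(-X) - (-X)σ'`, a coboundary.  Used by: orientation rigidity of reducible realisers, the
Greenberg condition of the realised cocycle at `p`, the residual pairing of symplectic realisers (design note Lines/sector-klingen-split-next.md).
-/

noncomputable section

open scoped MatrixGroups Matrix

set_option linter.dupNamespace false
set_option autoImplicit false

namespace Summit.Langlands.Langlands.Cruxes.ResiduallyYoshidaLifting.SectorKlingenSplit.Ribet

open Literature.NumberTheory.GaloisRepresentations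

/-! ### Stable subspaces of an irreducible matrix representation -/

section Stable

variable {k : Type*} [Field k] {Γ : Type*} [Group Γ]

/-- A subspace of `kⁿ` stable under an IRREDUCIBLE matrix representation `τ : Γ → GLₙ(k)` is `⊥` or `⊤`
(it is a subrepresentation of the standard representation). [folklore] -/
theorem submodule_eq_bot_or_top_of_stable {n : ℕ} (τ : Γ →* GL (Fin n) k)
    (hτ : Representation.IsIrreducible ((glStdRepresentation (Fin n) k).comp τ))
    (U : Submodule k (Fin n → k)) (hU : ∀ g, ∀ u ∈ U, (τ g).val *ᵥ u ∈ U) :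
    U = ⊥ ∨ U = ⊤ := by
  haveI := hτ
  let U' : Subrepresentation ((glStdRepresentation (Fin n) k).comp τ) :=
    { toSubmodule := U
      apply_mem_toSubmodule := fun g v hv => by
        change (τ g).val *ᵥ v ∈ U
        exact hU g v hv }
  rcases IsSimpleOrder.eq_bot_or_eq_top U' with h | h
  · exact Or.inl (congrArg Subrepresentation.toSubmodule h)
  · exact Or.inr (congrArg Subrepresentation.toSubmodule h)

end Stable

/-- **Registered statement `stub_nonsplitInvariantSubspaces`**: the stable subspaces of a non-split block upper-triangular
representation `(σ, B; 0, σ')` with irreducible diagonal blocks are `⊥`, the `σ`-plane, `⊤`. [folklore] -/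
theorem stub_nonsplitInvariantSubspaces :
    ∀ (k : Type) [Field k] (Γ : Type) [Group Γ] (σ σ' : Γ →* GL (Fin 2) k),
      Representation.IsIrreducible ((Literature.NumberTheory.GaloisRepresentations.glStdRepresentation (Fin 2) k).comp σ) →
      Representation.IsIrreducible ((Literature.NumberTheory.GaloisRepresentations.glStdRepresentation (Fin 2) k).comp σ') →
      ∀ (B : Γ → Matrix (Fin 2) (Fin 2) k),
      (¬ ∃ X : Matrix (Fin 2) (Fin 2) k, ∀ g, B g = (σ g).val * X - X * (σ' g).val) →
      ∀ (W : Submodule k (Fin 2 ⊕ Fin 2 → k)),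
      (∀ g, ∀ w ∈ W, (Matrix.fromBlocks (σ g).val (B g) 0 (σ' g).val).mulVec w ∈ W) →
      W = ⊥ ∨ W = ⊤ ∨ ∀ w : Fin 2 ⊕ Fin 2 → k, w ∈ W ↔ ∀ j : Fin 2, w (Sum.inr j) = 0 := by
  intro k _ Γ _ σ σ' hσ hσ' B hB W hW
  -- coordinates on `k² ⊕ k²` and the block action
  have hsplit : ∀ w : Fin 2 ⊕ Fin 2 → k, w = Sum.elim (w ∘ Sum.inl) (w ∘ Sum.inr) :=
    fun w => (Sum.elim_comp_inl_inr w).symm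
  have hadd : ∀ u u' v v' : Fin 2 → k, Sum.elim u v + Sum.elim u' v' = Sum.elim (u + u') (v + v') := by
    intro u u' v v'
    funext i
    rcases i with i | i <;> rfl
  have hsub : ∀ u u' v v' : Fin 2 → k, Sum.elim u v - Sum.elim u' v' = Sum.elim (u - u') (v - v') := by
    intro u u' v v'
    funext i
    rcases i with i | i <;> rfl
  have hsmul : ∀ (c : k) (u v : Fin 2 → k), c • Sum.elim u v = Sum.elim (c • u) (c • v) := by
    intro c u v
    funext i
    rcases i with i | i <;> rfl
  have hW' : ∀ g (u v : Fin 2 → k), Sum.elim u v ∈ W →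
      Sum.elim ((σ g).val *ᵥ u + B g *ᵥ v) ((σ' g).val *ᵥ v) ∈ W := fun g u v h => by
    have e := hW g _ h
    rwa [Matrix.fromBlocks_mulVec, Sum.elim_comp_inl, Sum.elim_comp_inr, Matrix.zero_mulVec,
      zero_add] at e
  -- (1) the image `U₂` of `W` in the quotient `σ'` and the trace `U₁` of `W` on the `σ`-plane
  obtain ⟨U₂, hU₂mem⟩ : ∃ U₂ : Submodule k (Fin 2 → k), ∀ v, v ∈ U₂ ↔ ∃ u, Sum.elim u v ∈ W := by
    refine ⟨W.map (LinearMap.funLeft k k Sum.inr), fun v => ?_⟩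
    rw [Submodule.mem_map]
    constructor
    · rintro ⟨w, hw, rfl⟩
      refine ⟨w ∘ Sum.inl, ?_⟩
      change Sum.elim (w ∘ Sum.inl) (w ∘ Sum.inr) ∈ W
      rw [Sum.elim_comp_inl_inr]
      exact hw
    · rintro ⟨u, hu⟩
      exact ⟨Sum.elim u v, hu, rfl⟩
  obtain ⟨U₁, hU₁mem⟩ : ∃ U₁ : Submodule k (Fin 2 → k), ∀ u, u ∈ U₁ ↔ Sum.elim u 0 ∈ W := by
    let ι : (Fin 2 → k) →ₗ[k] (Fin 2 ⊕ Fin 2 → k) :=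
      { toFun := fun u => Sum.elim u 0
        map_add' := fun u u' => by
          show Sum.elim (u + u') 0 = Sum.elim u 0 + Sum.elim u' 0
          rw [hadd, add_zero]
        map_smul' := fun c u => by
          show Sum.elim (c • u) 0 = c • Sum.elim u 0
          rw [hsmul, smul_zero] }
    exact ⟨W.comap ι, fun u => Iff.rfl⟩
  have hU₂ : U₂ = ⊥ ∨ U₂ = ⊤ := by
    refine submodule_eq_bot_or_top_of_stable σ' hσ' U₂ fun g v hv => ?_
    obtain ⟨u, hu⟩ := (hU₂mem v).mp hv
    exact (hU₂mem _).mpr ⟨_, hW' g u v hu⟩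
  have hU₁ : U₁ = ⊥ ∨ U₁ = ⊤ := by
    refine submodule_eq_bot_or_top_of_stable σ hσ U₁ fun g u hu => ?_
    rw [hU₁mem] at hu ⊢
    have e := hW' g u 0 hu
    rwa [Matrix.mulVec_zero, Matrix.mulVec_zero, add_zero] at e
  rcases hU₂ with hU₂ | hU₂
  · -- (2a) `U₂ = ⊥`: `W` lies in the `σ`-plane and is `U₁ ⊕ 0`
    have h2 : ∀ w ∈ W, w ∘ Sum.inr = 0 := fun w hw => by
      have e : w ∘ Sum.inr ∈ U₂ := (hU₂mem _).mpr ⟨w ∘ Sum.inl, by rw [Sum.elim_comp_inl_inr]; exact hw⟩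
      rwa [hU₂, Submodule.mem_bot] at e
    have h1 : ∀ w ∈ W, w ∘ Sum.inl ∈ U₁ := fun w hw => by
      rw [hU₁mem]
      have e := hsplit w
      rw [h2 w hw] at e
      rw [← e]
      exact hw
    rcases hU₁ with hU₁ | hU₁
    · left
      refine (Submodule.eq_bot_iff W).mpr fun w hw => ?_
      have e1 := h1 w hw
      rw [hU₁, Submodule.mem_bot] at e1
      rw [hsplit w, e1, h2 w hw]
      funext i
      rcases i with i | i <;> rfl
    · right; right
      intro w
      constructor
      · intro hw j
        exact congrFun (h2 w hw) j
      · intro hw0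
        have e2 : w ∘ Sum.inr = 0 := funext hw0
        have e1 : w ∘ Sum.inl ∈ U₁ := by
          rw [hU₁]
          exact Submodule.mem_top
        rw [hU₁mem] at e1
        rw [hsplit w, e2]
        exact e1
  · -- (2b) `U₂ = ⊤`
    have hex : ∀ v : Fin 2 → k, ∃ u, Sum.elim u v ∈ W := fun v =>
      (hU₂mem v).mp (by rw [hU₂]; exact Submodule.mem_top)
    rcases hU₁ with hU₁ | hU₁
    · -- `U₁ = ⊥`: `W` is the graph of a linear `X`, and stability makes `B` a coboundary
      exfalso
      have huniq : ∀ u u' v : Fin 2 → k, Sum.elim u v ∈ W → Sum.elim u' v ∈ W → u = u' :=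
        fun u u' v h h' => by
          have hd := W.sub_mem h h'
          rw [hsub, sub_self, ← hU₁mem, hU₁, Submodule.mem_bot] at hd
          exact sub_eq_zero.mp hd
      choose X₀ hX₀ using hex
      let X : (Fin 2 → k) →ₗ[k] (Fin 2 → k) :=
        { toFun := X₀
          map_add' := fun v v' => huniq _ _ _ (hX₀ _) (by
            rw [← hadd]
            exact W.add_mem (hX₀ v) (hX₀ v'))
          map_smul' := fun c v => huniq _ _ _ (hX₀ _) (by
            rw [RingHom.id_apply, ← hsmul]
            exact W.smul_mem c (hX₀ v)) }
      obtain ⟨Xm, hXm⟩ : ∃ Xm : Matrix (Fin 2) (Fin 2) k, ∀ v, Xm *ᵥ v = X₀ v :=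
        ⟨LinearMap.toMatrix' X, fun v => LinearMap.toMatrix'_mulVec X v⟩
      refine hB ⟨-Xm, fun g => ?_⟩
      have key : (σ g).val * Xm + B g = Xm * (σ' g).val := by
        refine Matrix.ext_iff_mulVec.mpr fun v => ?_
        rw [Matrix.add_mulVec, ← Matrix.mulVec_mulVec, ← Matrix.mulVec_mulVec, hXm, hXm]
        exact huniq _ _ _ (hW' g _ v (hX₀ v)) (hX₀ _)
      rw [mul_neg, neg_mul, ← key]
      abel
    · -- `U₁ = ⊤`: the `σ`-plane lies in `W` and `W` maps onto the quotient, so `W = ⊤`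
      right; left
      refine Submodule.eq_top_iff'.mpr fun w => ?_
      obtain ⟨u, hu⟩ := hex (w ∘ Sum.inr)
      have e1 : w ∘ Sum.inl - u ∈ U₁ := by
        rw [hU₁]
        exact Submodule.mem_top
      rw [hU₁mem] at e1
      have e := W.add_mem e1 hu
      rwa [hadd, sub_add_cancel, zero_add, ← hsplit w] at e

end Summit.Langlands.Langlands.Cruxes.ResiduallyYoshidaLifting.SectorKlingenSplit.Ribet

end
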